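import Summits.BirchSwinnertonDyer.BirchSwinnertonDyer.Theses.PrintCFram
import Summits.BirchSwinnertonDyer.BirchSwinnertonDyer.Theorems.RamifiedSevenEllipticUnitsRubinFormulaZpBsdp
import Summits.BirchSwinnertonDyer.BirchSwinnertonDyer.Theorems.AdditiveRankOneBSDpOfExactIndexManin
import Summits.BirchSwinnertonDyer.Rank1Residual.X11b.BDPRouteOnTreeStepL
import Summits.BirchSwinnertonDyer.Rank1Residual.Partition.CornersCM
import Literature.NumberTheory.EllipticCurves.NonvanishingTwistsHoffsteinLuo
import HarnessLib

/-!
# Crux `PrintCFram.BottomClassIndexLawFiveLe` (stmt-BirchSwinnertonDyer-20372) — line `borel_heegner_squeeze`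
# (ideator seat `bsd-idea-7` g4, lens «complete»; PUBLISH-ONLY skeleton, not the line of record)

HONEST FRAMING. Nothing about BSD is proved here. Four `sorry`s, all inside `stub_*`; the composition
`BottomClassIndexLawFiveLe_of` is kernel-checked and concludes the crux BY NAME. The line of record for this
crux is the LEAD's `Lines/eisenstein_resource_bdp_line.lean` (cell `bsd-print-cfram`); this file is a second,
independent line and never touches the lead's paths or stubs. BSD is not proved by any of this.

THE CLASS. `W/ℚ` with CM by `𝓞_K`, `K = ℚ(√-p)`, `p ∈ {7, 11, 19, 43, 67, 163}` RAMIFIED in `K`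
(`CMRamified W p`), `5 ≤ p`, `r_an(W) = 1`: quadratic twists of the Gross curves `A(p)`; `p² ∥ N_W`, additive
potentially supersingular reduction at `p`, `W[𝔭]` a `G_ℚ`-stable line (`ρ̄_{W,p}` BOREL, `a_p = 0`, `U_p`-slope `∞`).

THE LINE (Heegner–Kolyvagin at the Borel CM-ramified prime, `p`-adic-`L`-function-FREE). Choose an auxiliary
HEEGNER field `K'' ≠ K` for `N_W` with `d_{K''}` odd, `|d_{K''}|` large and `L(W^{d_{K''}}, 1) ≠ 0`
(Friedberg–Hoffstein / Hoffstein–Luo, in print; `p ∣ N_W` is then SPLIT in `K''`). The tree's Manin-robust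
exact-index socket `SchneiderFree.Exact.bsdp_of_exactIndexManin_of_partner_bsdp` (THEOREM; Gross–Zagier I.(6.3)+(7.3),
Kolyvagin finiteness, GZK, modularity as named facts; NO surjectivity of `ρ̄`, NO `p ∤ c_Manin`) turns the PAIR of
finite-level `p`-adic Heegner-index inequalities at Manin slack `s = v_p(c(Dt))`,
* UPPER  `ord_p #Ш(W/K'') + 2·ord_p ∏ c_ℓ(W) + 2s ≤ 2·ord_p [W(K'') : ℤ·P]`   (`stub_kolyvaginUpper_borelCM`),
* LOWER  `2·ord_p [W(K'') : ℤ·P] ≤ ord_p #Ш(W/K'') + 2·ord_p ∏ c_ℓ(W) + 2s`   (`stub_indexLower_borelCM`),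
plus `BSD_p` of the rank-zero CM partner `W^{d_{K''}}` (Burungale–Flach 2024 via `bsdp_cm_rankZero`, print) into
`BSDp W p`; the K7r dictionary `RubinFormulaZpBsdp.ramifiedCMBottomClassIndexLawAtZp_of_bsdp` (THEOREM; Cassels,
modularity, GZK) then gives the crux's conclusion `RamifiedCMBottomClassIndexLawAtZp W p`.

WHAT IS NEW / WHERE THE RESEARCH IS. UPPER is Kolyvagin's inequality for the Heegner-point Euler system of `W/K''`
at a prime where `ρ̄` is REDUCIBLE, `W` HAS CM and `p² ∣ N` — outside every printed hypothesis set
(Kolyvagin 1990 / Gross 1991: `ρ̄` onto; Cha 2005: `p² ∤ N`, `ρ̄` irreducible; Grigorov–Jorza–Patrikis–Stein–Tarniţă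
2009 Thm. 3.7 / Miller 2011 Thm. 5.3: Borel allowed but NON-CM; Jetchev 2008: Tamagawa-sharpened, same image
hypotheses; Castella–Grossi–Lee–Skinner 2022: Eisenstein `p` of GOOD ORDINARY reduction, `Λ`-adic). Proposed
instrument (card `Ideas/borel-heegner-squeeze.md`): run Kolyvagin's derivative classes with the `𝓞_𝔭`-structure —
over `F = K·K''` the Tate module is `𝓞_𝔭`-linear of rank one with residual character `χ`, `χ² = ω|_{G_K}` — and
dodge the one-eigenline obstruction (a Selmer class with values in the `G_ℚ`-line `W[𝔭]`, which is a
`τ`-eigenline of fixed sign) by the ISOGENY SWITCH `W ↔ W/W[𝔭] ≅ W^{(-p)}` (same `L`-function, stable line of the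
opposite `τ`-sign; Cassels invariance of the BSD quotient is a named fact). No `p`-adic `L`-function, no `Λ`, no
reciprocity law, no Eisenstein congruence enters UPPER: the barrier `CMRankOneAtRamifiedPrime` (`U_p`-slope `∞`
kills cyclotomic/BDP `p`-adic objects) is not met by it. LOWER is JSW's STEP L read on this class at finite level
(research-XL; the SAME WALL as the lead's `β1`/(AN), which imply it through the `♭`-BDP value formula and control —
declared, not hidden); its only `Λ`-free instrument on record is Kolyvagin-primitivity (`W. Zhang 2014`), which has
no mechanism at an additive Eisenstein prime (dead end recorded in the card).

STUBS (4): `stub_prints_borel` (8 refereed facts, by name) · `stub_heegnerFrame_cmRamified` (assembly, size M: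
a full anticyclotomic frame for every class member, FROM the two existence facts it names — hypothesis-taking,
not smuggled) · `stub_kolyvaginUpper_borelCM` (research-M/L, the line's new instrument) ·
`stub_indexLower_borelCM` (research-XL, hardest). Composition: `BottomClassIndexLawFiveLe_of`.

References: [GrossZagier1986] Thm. I.(6.3), (7.3); [Kolyvagin1990] Thm. A; [Gross1991] §§3–5;
[GrigorovJorzaPatrikisSteinTarnita2009] Thm. 3.7, Props. 5.2–5.4 (Math. Comp. 78, pp. 2406, 2415);
[Miller2011LMS] Thms. 5.2–5.4 (arXiv:1010.2431 p. 11); [Cha2005]; [Jetchev2008]; [JetchevSkinnerWan2017] §7.4.1;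
[CastellaGrossiLeeSkinner2022] Thm. 5.1.1; [LawsonWuthrich2016]; [Edixhoven1991] Thm. 3; [BurungaleFlach2024]
Thm. 1.1; [FriedbergHoffstein1995] Thm. B; [HoffsteinLuo1997]; [Cassels1965ArithmeticVIII]; [BurungaleKobayashiNakamuraOta2026] §1.4.
-/

set_option autoImplicit false
-- `…Cruxes.<CruxDecl>.<Slug>` is the mandated namespace of a crux line (CRUX WORKFILES); it repeats a path component.
set_option linter.dupNamespace false

noncomputable section

open scoped Classical
open NumberField IsDedekindDomain Field WeierstrassCurve
open Literature.NumberTheory.EllipticCurves Literature.NumberTheory.EllipticCurves.ModularForms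
open Literature.NumberTheory.EllipticCurves.Rank1Residual
open Summit.BirchSwinnertonDyer.Rank1Residual Summit.BirchSwinnertonDyer.Rank1Residual.X12.O11
open Summit.BirchSwinnertonDyer.BirchSwinnertonDyer.Theorems.SchneiderFree
open Summit.BirchSwinnertonDyer.BirchSwinnertonDyer.Theorems.RamifiedSevenEllipticUnits

namespace Summit.BirchSwinnertonDyer.BirchSwinnertonDyer.Cruxes.BottomClassIndexLawFiveLe.BorelHeegnerSqueeze

/-- **S0 · PRINT.** The eight refereed inputs of the line, each a named Literature fact consumed BY NAME:
Gross–Zagier I.(6.3) (`gross_zagier`), Kolyvagin's finiteness theorem (`kolyvagin`), modularity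
(`hasEntireLFunction_rat`, `exists_isNewformOf`), Gross–Zagier I.(7.3) for the twist's central value,
Cassels' isogeny invariance of the BSD quotient, Burungale–Flach (BSD for CM curves with `L(E,1) ≠ 0`),
Hoffstein–Luo / Friedberg–Hoffstein non-vanishing of a twist with prescribed splitting. Size: print. -/
theorem stub_prints_borel :
    (∀ (N : ℕ) [NeZero N] (W : WeierstrassCurve ℚ) (K : Type) [Field K] [NumberField K], gross_zagier N W K) ∧
    (∀ (N : ℕ) [NeZero N] (W : WeierstrassCurve ℚ) (K : Type) [Field K] [NumberField K], kolyvagin N W K) ∧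
    hasEntireLFunction_rat ∧ GrossZagier1986_thm_I_7_3 ∧ bsdRHS_eq_of_isIsogenous ∧
    bsdTriple_of_hasCM_of_L_one_ne_zero ∧ exists_isNewformOf ∧ HoffsteinLuo1997_exists_twist_L_one_ne_zero := by
  sorry

/-- **S1 · ASSEMBLY (size M) — a full anticyclotomic Heegner frame exists for every class member**, FROM the two
existence facts named as antecedents (modularity `exists_isNewformOf`; Hoffstein–Luo ⇒ Friedberg–Hoffstein with
odd discriminant and prescribed splitting, tree `exists_neg_fundamental_twist_ne_zero_of_hoffsteinLuo`): an
imaginary quadratic `K''` with `d_{K''}` odd, Heegner for `N = N_W` (so the additive `p ∣ N` splits in `K''`),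
`p ∤ #𝓞_{K''}^×`, `L(W^{d_{K''}},1) ≠ 0`; a parametrisation datum `Dt` at level `N`
(`nonempty_modularParametrizationData`), a Heegner datum `H` (`nonempty_heegnerDatum_holds`), an embedding `ι`,
the Heegner point `P ∈ W(K'')` (`heegnerPointComplex_mem_range_map_holds`), and a globally minimal model `Wd` of
the twist (`hasGlobalMinimalModel_rat_holds`), which is again CM (`twistModel_facts`). Why it might fail: it
should not — every piece is a tree theorem or a named fact; the only bookkeeping risk is `p ∣ N`
(`CMRamified ⇒` additive at `p`, `dvd_conductorNorm_iff_not_hasGoodReductionAtPrime`). -/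
theorem stub_heegnerFrame_cmRamified :
    exists_isNewformOf → HoffsteinLuo1997_exists_twist_L_one_ne_zero →
    ∀ (W : WeierstrassCurve ℚ) [W.IsElliptic] [W.IsGloballyMinimal] (p : ℕ) [Fact p.Prime],
      W.HasCM → CMRamified W p → 5 ≤ p → W.analyticRank = 1 →
      ∃ (N : ℕ) (_ : NeZero N) (K : Type) (_ : Field K) (_ : NumberField K)
        (Dt : ModularParametrizationData W N) (H : HeegnerDatum N (NumberField.discr K)) (ι : K →+* ℂ)
        (P : (W.baseChange K).toAffine.Point) (Wd : WeierstrassCurve ℚ) (_ : Wd.IsElliptic)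
        (_ : Wd.IsGloballyMinimal),
        W.conductorNorm ℤ = N ∧ p ∣ N ∧ IsImaginaryQuadratic K ∧ Odd (NumberField.discr K) ∧
        ¬ p ∣ Units.torsionOrder K ∧ SatisfiesHeegnerHypothesis N K ∧
        (W.quadraticTwist (NumberField.discr K : ℚ)).entireLFunction 1 ≠ 0 ∧
        WeierstrassCurve.Affine.Point.map ι.toRatAlgHom P = heegnerPointComplex Dt H ∧
        (∃ C : VariableChange ℚ, C • W.quadraticTwist (NumberField.discr K : ℚ) = Wd) ∧ Wd.HasCM := by
  sorry

/-- **S2 · RESEARCH-M/L (the line's new instrument) — Kolyvagin's inequality at the BOREL CM-ramified prime,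
Tamagawa-sharpened (Jetchev) and at Manin slack `v_p(c(Dt))`, for EVERY anticyclotomic frame of a class member:**
`ord_p #Ш(W/K'') + 2·ord_p ∏ c_ℓ(W) + 2·v_p(c) ≤ 2·ord_p [W(K'') : ℤ·P]` (the tree's co-STEP-L predicate
`SchneiderFree.Upper.IndexUpperBoundLeAt`). In print ONLY under hypotheses the class violates (`ρ̄` onto:
Kolyvagin/Gross; `p² ∤ N` + irreducible: Cha; non-CM: GJPST Thm. 3.7 / Miller Thm. 5.3; good ordinary Eisenstein:
CGLS). Instrument: Kolyvagin's derivative classes with `𝓞_𝔭`-coefficients over `F = K·K''` + the isogeny switch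
`W ↔ W/W[𝔭]`; GJPST Props. 5.2–5.4 (cohomological vanishing from `p ∤ #E'(K'')_tors`, automatic here for
`p ≥ 7` by Mazur, and for `p = 7` on the `49a`-class) replace surjectivity in Gross's §4. Why it might fail: a
Selmer class with values in the `τ`-eigenline `W[𝔭]` of the wrong sign may be invisible to every Kolyvagin prime
(Gross Prop. 5.3 analogue), and `p² ∣ N` changes the local condition at the primes of `K''` above `p`
(additive reduction: `W(K''_v) ⊗ ℚ_p/ℤ_p = 0` up to `c_p`, so the finite/singular bookkeeping at `v ∣ p` is
not Cha's flat one). [cite: GrigorovJorzaPatrikisSteinTarnita2009, Thm. 3.7] [cite: Miller2011LMS, Thm. 5.3]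
[cite: JetchevSkinnerWan2017, §7.4.1] -/
theorem stub_kolyvaginUpper_borelCM :
    ∀ (W : WeierstrassCurve ℚ) [W.IsElliptic] [W.IsGloballyMinimal] (p : ℕ) [Fact p.Prime],
      W.HasCM → CMRamified W p → 5 ≤ p → W.analyticRank = 1 →
      ∀ (N : ℕ) [NeZero N] (K : Type) [Field K] [NumberField K]
        (Dt : ModularParametrizationData W N) (H : HeegnerDatum N (NumberField.discr K)) (ι : K →+* ℂ)
        (P : (W.baseChange K).toAffine.Point),
        W.conductorNorm ℤ = N → IsImaginaryQuadratic K → Odd (NumberField.discr K) →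
        ¬ p ∣ Units.torsionOrder K → SatisfiesHeegnerHypothesis N K →
        (W.quadraticTwist (NumberField.discr K : ℚ)).entireLFunction 1 ≠ 0 →
        WeierstrassCurve.Affine.Point.map ι.toRatAlgHom P = heegnerPointComplex Dt H →
        ¬ IsOfFinAddOrder P →
        Upper.IndexUpperBoundLeAt W p K P (padicValNat p Dt.c.natAbs) := by
  sorry

/-- **S3 · RESEARCH-XL (hardest; SAME WALL as the lead's `β1`/(AN), declared) — the LOWER Heegner-index
inequality (JSW's STEP L) on the class, at finite level and Manin slack:**
`2·ord_p [W(K'') : ℤ·P] ≤ ord_p #Ш(W/K'') + 2·ord_p ∏ c_ℓ(W) + 2·v_p(c)` (the tree's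
`SchneiderFree.IndexLowerBoundLeAt`). Printed STEP L (JSW 2017 §7.4.1, Keller–Yin 2024) needs the BDP main
conjecture at a prime of good (or at worst multiplicative) reduction; here `p² ∣ N`. Instruments on record:
(i) the lead's `♭`-(∅,0) chain (`β1` + (AN) ⇒ `♭`-IMC equality ⇒ this inequality through the `♭`-BDP value
formula and anticyclotomic control) — so S3 is IMPLIED by the lead's research stubs and is the weaker, finite-level
currency of the same wall; (ii) Kolyvagin-primitivity `M_∞ = 0` (W. Zhang 2014) — NO mechanism at an additive
Eisenstein prime (level-raising to a rank-zero `BSD_p` at a supercuspidal Eisenstein `p` is not in print). Why it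
might fail: it is the missing lower bound on `Ш` at an Eisenstein prime of infinite slope — exactly where every
printed engine stops (barrier `CMRankOneAtRamifiedPrime`). [cite: JetchevSkinnerWan2017, §7.4.1]
[cite: KellerYin2024b, Thm. 3.5.1] [cite: Zhang2014, Thm. 1.1] -/
theorem stub_indexLower_borelCM :
    ∀ (W : WeierstrassCurve ℚ) [W.IsElliptic] [W.IsGloballyMinimal] (p : ℕ) [Fact p.Prime],
      W.HasCM → CMRamified W p → 5 ≤ p → W.analyticRank = 1 →
      ∀ (N : ℕ) [NeZero N] (K : Type) [Field K] [NumberField K]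
        (Dt : ModularParametrizationData W N) (H : HeegnerDatum N (NumberField.discr K)) (ι : K →+* ℂ)
        (P : (W.baseChange K).toAffine.Point),
        W.conductorNorm ℤ = N → IsImaginaryQuadratic K → Odd (NumberField.discr K) →
        ¬ p ∣ Units.torsionOrder K → SatisfiesHeegnerHypothesis N K →
        (W.quadraticTwist (NumberField.discr K : ℚ)).entireLFunction 1 ≠ 0 →
        WeierstrassCurve.Affine.Point.map ι.toRatAlgHom P = heegnerPointComplex Dt H →
        ¬ IsOfFinAddOrder P →
        IndexLowerBoundLeAt W p K P (padicValNat p Dt.c.natAbs) := by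
  sorry

/-- **COMPOSITION (kernel-checked, no `sorry`): S0 → S1 → S2 → S3 → the crux BY NAME.** For a class member:
take the frame of S1 (fed with the two existence facts of S0); the Heegner point is non-torsion
(`X11b.not_isOfFinAddOrder_of_heegner_of_analyticRank_eq_one`, Gross–Zagier); S2 and S3 give the two halves at
slack `v_p(c(Dt))`; the partner `Wd` has `r_an = 0` and CM, so `BSDp Wd p` (Burungale–Flach,
`bsdp_cm_rankZero`); the socket `SchneiderFree.Exact.bsdp_of_exactIndexManin_of_partner_bsdp` gives `BSDp W p`;
the K7r dictionary `RubinFormulaZpBsdp.ramifiedCMBottomClassIndexLawAtZp_of_bsdp` gives the crux's conclusion. -/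
theorem BottomClassIndexLawFiveLe_of :
    ((∀ (N : ℕ) [NeZero N] (W : WeierstrassCurve ℚ) (K : Type) [Field K] [NumberField K], gross_zagier N W K) ∧
      (∀ (N : ℕ) [NeZero N] (W : WeierstrassCurve ℚ) (K : Type) [Field K] [NumberField K], kolyvagin N W K) ∧
      hasEntireLFunction_rat ∧ GrossZagier1986_thm_I_7_3 ∧ bsdRHS_eq_of_isIsogenous ∧
      bsdTriple_of_hasCM_of_L_one_ne_zero ∧ exists_isNewformOf ∧ HoffsteinLuo1997_exists_twist_L_one_ne_zero) →
    (exists_isNewformOf → HoffsteinLuo1997_exists_twist_L_one_ne_zero →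
      ∀ (W : WeierstrassCurve ℚ) [W.IsElliptic] [W.IsGloballyMinimal] (p : ℕ) [Fact p.Prime],
        W.HasCM → CMRamified W p → 5 ≤ p → W.analyticRank = 1 →
        ∃ (N : ℕ) (_ : NeZero N) (K : Type) (_ : Field K) (_ : NumberField K)
          (Dt : ModularParametrizationData W N) (H : HeegnerDatum N (NumberField.discr K)) (ι : K →+* ℂ)
          (P : (W.baseChange K).toAffine.Point) (Wd : WeierstrassCurve ℚ) (_ : Wd.IsElliptic)
          (_ : Wd.IsGloballyMinimal),
          W.conductorNorm ℤ = N ∧ p ∣ N ∧ IsImaginaryQuadratic K ∧ Odd (NumberField.discr K) ∧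
          ¬ p ∣ Units.torsionOrder K ∧ SatisfiesHeegnerHypothesis N K ∧
          (W.quadraticTwist (NumberField.discr K : ℚ)).entireLFunction 1 ≠ 0 ∧
          WeierstrassCurve.Affine.Point.map ι.toRatAlgHom P = heegnerPointComplex Dt H ∧
          (∃ C : VariableChange ℚ, C • W.quadraticTwist (NumberField.discr K : ℚ) = Wd) ∧ Wd.HasCM) →
    (∀ (W : WeierstrassCurve ℚ) [W.IsElliptic] [W.IsGloballyMinimal] (p : ℕ) [Fact p.Prime],
      W.HasCM → CMRamified W p → 5 ≤ p → W.analyticRank = 1 →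
      ∀ (N : ℕ) [NeZero N] (K : Type) [Field K] [NumberField K]
        (Dt : ModularParametrizationData W N) (H : HeegnerDatum N (NumberField.discr K)) (ι : K →+* ℂ)
        (P : (W.baseChange K).toAffine.Point),
        W.conductorNorm ℤ = N → IsImaginaryQuadratic K → Odd (NumberField.discr K) →
        ¬ p ∣ Units.torsionOrder K → SatisfiesHeegnerHypothesis N K →
        (W.quadraticTwist (NumberField.discr K : ℚ)).entireLFunction 1 ≠ 0 →
        WeierstrassCurve.Affine.Point.map ι.toRatAlgHom P = heegnerPointComplex Dt H →
        ¬ IsOfFinAddOrder P →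
        Upper.IndexUpperBoundLeAt W p K P (padicValNat p Dt.c.natAbs)) →
    (∀ (W : WeierstrassCurve ℚ) [W.IsElliptic] [W.IsGloballyMinimal] (p : ℕ) [Fact p.Prime],
      W.HasCM → CMRamified W p → 5 ≤ p → W.analyticRank = 1 →
      ∀ (N : ℕ) [NeZero N] (K : Type) [Field K] [NumberField K]
        (Dt : ModularParametrizationData W N) (H : HeegnerDatum N (NumberField.discr K)) (ι : K →+* ℂ)
        (P : (W.baseChange K).toAffine.Point),
        W.conductorNorm ℤ = N → IsImaginaryQuadratic K → Odd (NumberField.discr K) →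
        ¬ p ∣ Units.torsionOrder K → SatisfiesHeegnerHypothesis N K →
        (W.quadraticTwist (NumberField.discr K : ℚ)).entireLFunction 1 ≠ 0 →
        WeierstrassCurve.Affine.Point.map ι.toRatAlgHom P = heegnerPointComplex Dt H →
        ¬ IsOfFinAddOrder P →
        IndexLowerBoundLeAt W p K P (padicValNat p Dt.c.natAbs)) →
    Summit.BirchSwinnertonDyer.BirchSwinnertonDyer.Theses.PrintCFram.BottomClassIndexLawFiveLe := by
  intro hS0 hS1 hS2 hS3
  obtain ⟨hGZ, hKo, hmod, hGZ73, hCassels, hBF, hnf, hHL⟩ := hS0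
  intro hGZK W _ _ p _ hCM hram h5 hr
  have hpP : p.Prime := Fact.out
  have hp2 : p ≠ 2 := by
    rintro rfl
    omega
  obtain ⟨N, _, K, _, _, Dt, H, ι, P, Wd, _, _, hN, hpN, hK, hodd, hw, hHH, hLd, hP, hC, hWdCM⟩ :=
    hS1 hnf hHL W p hCM hram h5 hr
  have hPinf : ¬ IsOfFinAddOrder P :=
    X11b.not_isOfFinAddOrder_of_heegner_of_analyticRank_eq_one W N K Dt H ι P (hGZ N W K) hmod hr hK hHH hLd hP
  have hup : Upper.IndexUpperBoundLeAt W p K P (padicValNat p Dt.c.natAbs) :=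
    hS2 W p hCM hram h5 hr N K Dt H ι P hN hK hodd hw hHH hLd hP hPinf
  have hlo : IndexLowerBoundLeAt W p K P (padicValNat p Dt.c.natAbs) :=
    hS3 W p hCM hram h5 hr N K Dt H ι P hN hK hodd hw hHH hLd hP hPinf
  -- the rank-zero CM partner: `L(Wd, 1) ≠ 0`, hence `r_an(Wd) = 0`, hence `BSD_p(Wd)` (Burungale–Flach)
  obtain ⟨Cd, hCd⟩ := hC
  have hD0 : (NumberField.discr K : ℚ) ≠ 0 := by exact_mod_cast NumberField.discr_ne_zero K
  haveI : (W.quadraticTwist (NumberField.discr K : ℚ)).IsElliptic := W.isElliptic_quadraticTwist hD0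
  have hLd1 : Wd.entireLFunction 1 ≠ 0 := by rw [← hCd, entireLFunction_smul]; exact hLd
  have hrd : Wd.analyticRank = 0 := analyticRank_eq_zero_of_entireLFunction_one_ne_zero Wd hLd1
  have hWd : BSDp Wd p := bsdp_cm_rankZero hBF hmod hWdCM hrd
  have hB : BSDp W p :=
    Exact.bsdp_of_exactIndexManin_of_partner_bsdp hGZ hKo hGZK hmod hGZ73 W p N K Dt H ι P Wd hr hN hpN hK hodd
      hw hHH hLd hP ⟨Cd, hCd⟩ hp2 hlo hup hWd
  exact RubinFormulaZpBsdp.ramifiedCMBottomClassIndexLawAtZp_of_bsdp hCassels hmod hGZK hr.le hB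

end Summit.BirchSwinnertonDyer.BirchSwinnertonDyer.Cruxes.BottomClassIndexLawFiveLe.BorelHeegnerSqueeze

end
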